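import Summits.Schanuel.Schanuel.Theses.RigidCore
import Summits.Schanuel.Schanuel.Theorems.AclSubsetLogFreeCore.Negative.ExpAclField

/-!
# Route `RigidCore`, support item `LogFreeCoreSubsetAcl` (stmt-Schanuel-0972): `C_EA ⊆ acl^{ℂ_exp}(∅)`

The log-free core `C_EA := sInf {K : IntermediateField ℚ ℂ | 2πi ∈ K ∧ K exp-closed ∧ K relatively
algebraically closed in ℂ}` is contained in `acl^{ℂ_exp}(∅)`, the union of the finite
`∅`-definable subsets of `(ℂ, +, ·, exp)` (Mathlib `Set.Definable₁ ∅ Language.expRing`).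

Proof: the definability library landed for the crux `AclSubsetLogFreeCore`
(`Theorems/AclSubsetLogFreeCore/Negative/{LogFreeCoreObjects, ExpAclDefinability, ExpAclField}`)
shows that `acl(∅)` is an intermediate field of `ℂ/ℚ` (`expAclField`) closed under `exp`
(`exp_mem_expAcl`), relatively algebraically closed (`expAcl_relAlgClosed`) and containing `2πi`
(`two_pi_I_mem_expAcl`, via KMO's parameter-free definitions of `ℤ` and `{±2πi}`); hence it is a
member of the family whose infimum is `C_EA`, and `sInf_le` gives the inclusion
(`logFreeCore_subset_expAcl`).  The objects `logFreeCore`, `expAcl` of that library are verbatim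
the set-builders of the route declaration, so the item closes by unfolding.

## References

* [Marker2002] D. Marker, *Model Theory: An Introduction*, GTM 217, §1.3 / Ex. 1.4.10 (`acl`).
* [KirbyMacintyreOnshuus2012] J. Kirby, A. Macintyre, A. Onshuus, arXiv:1101.4224, §2.1
  (`ℤ`, `±2πi` are `∅`-definable in `ℂ_exp`).
-/

namespace Summit.Schanuel.Schanuel.Theorems

/-- **Item stmt-Schanuel-0972 (`RigidCore.LogFreeCoreSubsetAcl`), proved**: every element of the
log-free core `C_EA = sInf {K | 2πi ∈ K, K exp-closed, K relatively algebraically closed}` lies in a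
finite `∅`-definable subset of `ℂ_exp`, i.e. `C_EA ⊆ acl^{ℂ_exp}(∅)`.  Immediate from
`AclSubsetLogFreeCore.Negative.logFreeCore_subset_expAcl` (`acl(∅)` is itself a member of the
family). [folklore] -/
theorem logFreeCoreSubsetAcl_proof :
    Summit.Schanuel.Schanuel.Theses.RigidCore.LogFreeCoreSubsetAcl := by
  unfold Summit.Schanuel.Schanuel.Theses.RigidCore.LogFreeCoreSubsetAcl
  intro a ha
  exact AclSubsetLogFreeCore.Negative.logFreeCore_subset_expAcl ha

end Summit.Schanuel.Schanuel.Theorems
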